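import Mathlib
import HarnessLib
import Literature.Analysis.FluidPDE.SuitableWeak
import Literature.Analysis.FluidPDE.SelfSimilar
import Literature.Analysis.FluidPDE.LocalTypeI
import Literature.Analysis.FluidPDE.VectorCalculus
import Literature.Analysis.FluidPDE.OseenMildUniqueness
import Literature.Analysis.FluidPDE.NSBoundedMildSmoothing
import Literature.Analysis.FluidPDE.KatoSymmetryCovariance
import Literature.Analysis.FluidPDE.KNSSOseenMildDecayTools
import Literature.Analysis.FluidPDE.KNSSSmoothingHolds
import Literature.Analysis.UnboundedOperators.HeatKernel
import Summits.NavierStokesRegularity.NavierStokesRegularity.Theorems.IsobarTomographyTubeAlternativeStubOseenAncientAnalytic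

/-!
# Route `LocalSineTubeDoor`, crux `ProfileAlignedWindowRigidity` (stmt-NavierStokesRegularity-20018) —
# support file 2/3: the Oseen-ancient class (analyticity, propagation of slice invariance, gradient bound)

Port to `Theorems/` of the class-𝔄 part of the cell proof
`Summit.NavierStokesRegularity.NavierStokesRegularity.Cell.NsRegP1c.profileAlignedWindowRigidity_holds`
(cell ns-regularity-ideate, seat p1, `Sketch5.lean`/`Sketch8A.lean`, kernel-checked there; landed by seat p6 as
route-directed support, `--supports stmt-NavierStokesRegularity-20018`).

The OSEEN-ANCIENT class 𝔄 of the cell (no new definition is introduced; its four properties are carried as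
explicit hypotheses `hcont`, `hbdd`, `hmild`, `hdiv` throughout): a field `v : ℝ → ℝ³ → ℝ³` with
`uncurry v` continuous on the open slab `(−∞,0) × ℝ³`, bounded on every sub-slab `(−∞,−δ)`, `δ > 0`,
satisfying the unit-viscosity Oseen (mild) identity
`v t y = heatExtension (v s) (t − s) y − oseenDuhamel 1 s v v t y` pointwise for all `s < t < 0`, and (where
needed) with divergence-free slices.  The route's Type-I profile class (rate `‖v(t,x)‖ ≤ C/√(−t)`) lies in 𝔄
(`bdd_of_hasTypeITimeDecay`).  Proved here:

* `shift` — time shifts `τ ↦ v(τ − δ)`, `δ > 0`, are GLOBALLY bounded continuous Oseen-ancient fields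
  (tree `oseenDuhamel_translate`);
* `analyticOnNhd_uncurry`, `analyticOnNhd_slice` — joint real-analyticity on the open slab (tree THEOREM
  `Theorems.TubeAlternative.AnalyticPropagation.stub_oseenAncientAnalytic` = Lemarié-Rieusset 2016 Thm 9.12 +
  bounded-mild uniqueness, applied to the shifts);
* `translate_eq_forward` — (F) invariance of a slice under translations along `e` propagates FORWARD in time
  (bounded-mild uniqueness `oseenMild_bounded_unique`, KNSS 2009 §4, + translation covariance of the heat and
  Oseen–Duhamel operators);
* `translate_eq_backward` — (T) … and BACKWARD to `−∞` (time analyticity + identity theorem on the connected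
  interval `(−∞,0)`: Masuda's 1967 move in place of backward uniqueness);
* `exists_fderiv_slice_bound` — (D) every slice has bounded gradient (KNSS 2009 Prop. 4.1 = tree THEOREM
  `knss2009_smoothing_holds`, `k = 1`, `l = 0`, restarted from the bounded continuous slice `v(2s)`; the
  pointwise mild identity identifies the smooth representative with `v s` itself).

WHAT THIS IS NOT: not a claim about Navier–Stokes regularity; support lemmas for a DRAFT route's crux.
-/

noncomputable section

open Set Filter Function MeasureTheory Metric
open scoped Topology ENNReal
open Literature.Analysis Literature.Analysis.FluidPDE

namespace Summit.NavierStokesRegularity.NavierStokesRegularity.Theorems.LocalSineTubeDoorProfileAlignedWindowRigidityAncient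

variable {v : ℝ → (EuclideanSpace ℝ (Fin 3)) → (EuclideanSpace ℝ (Fin 3))}

/-- The Type-I time rate `‖v(t,y)‖ ≤ C/√(−t)` bounds `v` by `|C|/√δ` on every sub-slab `(−∞,−δ)`, `δ > 0`:
the route's Type-I profile class lies in the Oseen-ancient class 𝔄. -/
theorem bdd_of_hasTypeITimeDecay {C : ℝ} (hrate : HasTypeITimeDecay C v) :
    ∀ δ : ℝ, 0 < δ → ∃ B : ℝ, ∀ t < -δ, ∀ y : (EuclideanSpace ℝ (Fin 3)), ‖v t y‖ ≤ B := by
  intro δ hδ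
  refine ⟨|C| / Real.sqrt δ, fun t ht y => ?_⟩
  have hδt : Real.sqrt δ ≤ Real.sqrt (-t) := Real.sqrt_le_sqrt (by linarith)
  have hsδ : 0 < Real.sqrt δ := Real.sqrt_pos.2 hδ
  calc ‖v t y‖ ≤ C / Real.sqrt (-t) := hrate t (by linarith) y
    _ ≤ |C| / Real.sqrt (-t) := div_le_div_of_nonneg_right (le_abs_self C) (Real.sqrt_nonneg _)
    _ ≤ |C| / Real.sqrt δ := div_le_div_of_nonneg_left (abs_nonneg C) hsδ hδt

/-- Slices `v t`, `t < 0`, of a field continuous on the open slab are continuous. -/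
theorem continuous_slice (hcont : ContinuousOn (uncurry v) (Iio (0 : ℝ) ×ˢ univ)) {t : ℝ}
    (ht : t < 0) : Continuous (v t) :=
  hcont.comp_continuous (continuous_const.prodMk continuous_id) fun x => ⟨ht, mem_univ x⟩

/-- **Time shift.** For `δ > 0` the field `τ ↦ v(τ − δ)` is continuous on the open slab, GLOBALLY bounded
on `(−∞,0)`, and satisfies the Oseen identity between any two negative times (time translation of the
Oseen–Duhamel operator, tree `oseenDuhamel_translate`). -/
theorem shift (hcont : ContinuousOn (uncurry v) (Iio (0 : ℝ) ×ˢ univ))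
    (hbdd : ∀ δ : ℝ, 0 < δ → ∃ B : ℝ, ∀ t < -δ, ∀ y : (EuclideanSpace ℝ (Fin 3)), ‖v t y‖ ≤ B)
    (hmild : ∀ s t : ℝ, s < t → t < 0 → ∀ y : (EuclideanSpace ℝ (Fin 3)),
      v t y = UnboundedOperators.heatExtension (v s) (t - s) y - oseenDuhamel 1 s v v t y)
    {δ : ℝ} (hδ : 0 < δ) :
    ContinuousOn (uncurry fun τ => v (τ + -δ)) (Iio (0 : ℝ) ×ˢ univ) ∧
    (∃ M : ℝ, ∀ t < 0, ∀ y : (EuclideanSpace ℝ (Fin 3)), ‖(fun τ => v (τ + -δ)) t y‖ ≤ M) ∧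
    (∀ s t : ℝ, s < t → t < 0 → ∀ y : (EuclideanSpace ℝ (Fin 3)),
      (fun τ => v (τ + -δ)) t y =
        UnboundedOperators.heatExtension ((fun τ => v (τ + -δ)) s) (t - s) y -
          oseenDuhamel 1 s (fun τ => v (τ + -δ)) (fun τ => v (τ + -δ)) t y) := by
  refine ⟨?_, ?_, ?_⟩
  · have hφ : Continuous fun z : ℝ × (EuclideanSpace ℝ (Fin 3)) => (z.1 + -δ, z.2) :=
      (continuous_fst.add continuous_const).prodMk continuous_snd
    have hmaps : MapsTo (fun z : ℝ × (EuclideanSpace ℝ (Fin 3)) => (z.1 + -δ, z.2)) (Iio (0 : ℝ) ×ˢ univ)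
        (Iio (0 : ℝ) ×ˢ univ) := by
      intro z hz
      obtain ⟨h1, -⟩ := mem_prod.1 hz
      refine mem_prod.2 ⟨?_, mem_univ _⟩
      simp only [mem_Iio] at h1 ⊢
      linarith
    exact hcont.comp hφ.continuousOn hmaps
  · obtain ⟨B, hB⟩ := hbdd δ hδ
    exact ⟨B, fun t ht y => hB (t + -δ) (by linarith) y⟩
  · intro s t hst ht0 y
    have h := hmild (s + -δ) (t + -δ) (by linarith) (by linarith) y
    have hts : t + -δ - (s + -δ) = t - s := by ring
    rw [hts] at h
    rw [oseenDuhamel_translate 1 s (-δ) v v t y]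
    exact h

/-- **Joint real-analyticity on the open slab** `(−∞,0) × ℝ³` of an Oseen-ancient field (tree THEOREM
`stub_oseenAncientAnalytic` — Lemarié-Rieusset 2016 Thm 9.12 + bounded-mild uniqueness — applied to the
globally bounded time shifts `τ ↦ v(τ − δ)` and translated back). -/
theorem analyticOnNhd_uncurry (hcont : ContinuousOn (uncurry v) (Iio (0 : ℝ) ×ˢ univ))
    (hbdd : ∀ δ : ℝ, 0 < δ → ∃ B : ℝ, ∀ t < -δ, ∀ y : (EuclideanSpace ℝ (Fin 3)), ‖v t y‖ ≤ B)
    (hmild : ∀ s t : ℝ, s < t → t < 0 → ∀ y : (EuclideanSpace ℝ (Fin 3)),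
      v t y = UnboundedOperators.heatExtension (v s) (t - s) y - oseenDuhamel 1 s v v t y) :
    AnalyticOnNhd ℝ (uncurry v) (Iio (0 : ℝ) ×ˢ univ) := by
  intro z hz
  obtain ⟨hz1, -⟩ := mem_prod.1 hz
  have hz1' : z.1 < 0 := hz1
  obtain ⟨δ, hδ0, hzδ⟩ : ∃ δ : ℝ, 0 < δ ∧ z.1 + δ < 0 := ⟨-z.1 / 2, by linarith, by linarith⟩
  obtain ⟨hc, hb, hm⟩ := shift hcont hbdd hmild hδ0
  have han :=
    Summit.NavierStokesRegularity.NavierStokesRegularity.Theorems.TubeAlternative.AnalyticPropagation.stub_oseenAncientAnalytic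
      (fun τ => v (τ + -δ)) hc hb hm
  have hw : AnalyticAt ℝ (uncurry fun τ => v (τ + -δ)) (z.1 + δ, z.2) :=
    han _ (mem_prod.2 ⟨hzδ, mem_univ _⟩)
  have hφ : AnalyticAt ℝ (fun p : ℝ × (EuclideanSpace ℝ (Fin 3)) => (p.1 + δ, p.2)) z :=
    (analyticAt_fst.add analyticAt_const).prod analyticAt_snd
  refine (hw.comp_of_eq hφ rfl).congr (Filter.Eventually.of_forall fun p => ?_)
  show v (p.1 + δ + -δ) p.2 = v p.1 p.2
  rw [add_neg_cancel_right]

/-- Slices `v t`, `t < 0`, of an Oseen-ancient field are real-analytic on `ℝ³`. -/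
theorem analyticOnNhd_slice (hcont : ContinuousOn (uncurry v) (Iio (0 : ℝ) ×ˢ univ))
    (hbdd : ∀ δ : ℝ, 0 < δ → ∃ B : ℝ, ∀ t < -δ, ∀ y : (EuclideanSpace ℝ (Fin 3)), ‖v t y‖ ≤ B)
    (hmild : ∀ s t : ℝ, s < t → t < 0 → ∀ y : (EuclideanSpace ℝ (Fin 3)),
      v t y = UnboundedOperators.heatExtension (v s) (t - s) y - oseenDuhamel 1 s v v t y)
    {t : ℝ} (ht : t < 0) : AnalyticOnNhd ℝ (v t) univ := by
  intro x _
  have hz : AnalyticAt ℝ (uncurry v) (t, x) :=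
    analyticOnNhd_uncurry hcont hbdd hmild (t, x) (mem_prod.2 ⟨ht, mem_univ _⟩)
  exact hz.comp (analyticAt_const.prod analyticAt_id)

/-- **(F) translation invariance propagates FORWARD** (bounded-mild uniqueness, tree THEOREM
`oseenMild_bounded_unique`: `v` and its translate `v(·, · + l e)` solve the same Oseen problem on `(s, t/2)`
from the same slice `v(s)`; continuous slices a.e. equal coincide).  If `v(s)` is invariant under translations
along `e`, so is every later slice `v(t)`, `s ≤ t < 0`. -/
theorem translate_eq_forward (hcont : ContinuousOn (uncurry v) (Iio (0 : ℝ) ×ˢ univ))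
    (hbdd : ∀ δ : ℝ, 0 < δ → ∃ B : ℝ, ∀ t < -δ, ∀ y : (EuclideanSpace ℝ (Fin 3)), ‖v t y‖ ≤ B)
    (hmild : ∀ s t : ℝ, s < t → t < 0 → ∀ y : (EuclideanSpace ℝ (Fin 3)),
      v t y = UnboundedOperators.heatExtension (v s) (t - s) y - oseenDuhamel 1 s v v t y)
    {s : ℝ} {e : (EuclideanSpace ℝ (Fin 3))} (h : ∀ (y : (EuclideanSpace ℝ (Fin 3))) (l : ℝ), v s (y + l • e) = v s y) :
    ∀ t, s ≤ t → t < 0 → ∀ (y : (EuclideanSpace ℝ (Fin 3))) (l : ℝ), v t (y + l • e) = v t y := by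
  intro t hst ht0
  rcases hst.eq_or_lt with rfl | hst'
  · exact h
  intro y l
  set a : (EuclideanSpace ℝ (Fin 3)) := l • e with ha
  obtain ⟨T₂, htT₂, hT₂0⟩ : ∃ T₂ : ℝ, t < T₂ ∧ T₂ < 0 := ⟨t / 2, by linarith, by linarith⟩
  obtain ⟨B, hB⟩ := hbdd (-T₂) (by linarith)
  have hB' : ∀ τ ∈ Ioo s T₂, ∀ y, ‖v τ y‖ ≤ max B 0 := fun τ hτ y =>
    (hB τ (by linarith [hτ.2]) y).trans (le_max_left _ _)
  have hsub : Ioo s T₂ ×ˢ (univ : Set (EuclideanSpace ℝ (Fin 3))) ⊆ Iio 0 ×ˢ univ :=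
    prod_mono (fun τ hτ => hτ.2.trans hT₂0) Subset.rfl
  have hum : AEStronglyMeasurable (uncurry v) (volume.restrict (Ioo s T₂ ×ˢ univ)) :=
    (hcont.mono hsub).aestronglyMeasurable (measurableSet_Ioo.prod MeasurableSet.univ)
  have hcont₂ : ContinuousOn (uncurry fun τ y => v τ (y + a)) (Ioo s T₂ ×ˢ univ) := by
    have hφ : Continuous fun z : ℝ × (EuclideanSpace ℝ (Fin 3)) => (z.1, z.2 + a) :=
      continuous_fst.prodMk (continuous_snd.add continuous_const)
    have hmaps : MapsTo (fun z : ℝ × (EuclideanSpace ℝ (Fin 3)) => (z.1, z.2 + a)) (Ioo s T₂ ×ˢ univ)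
        (Iio (0 : ℝ) ×ˢ univ) := fun z hz =>
      mem_prod.2 ⟨(mem_prod.1 hz).1.2.trans hT₂0, mem_univ _⟩
    exact hcont.comp hφ.continuousOn hmaps
  have hvm : AEStronglyMeasurable (uncurry fun τ y => v τ (y + a))
      (volume.restrict (Ioo s T₂ ×ˢ univ)) :=
    hcont₂.aestronglyMeasurable (measurableSet_Ioo.prod MeasurableSet.univ)
  have hvM : ∀ τ ∈ Ioo s T₂, ∀ y, ‖(fun τ y => v τ (y + a)) τ y‖ ≤ max B 0 := fun τ hτ y =>
    hB' τ hτ (y + a)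
  have hu : ∀ τ ∈ Ioo s T₂, v τ =ᵐ[volume] fun x =>
      UnboundedOperators.heatExtension (v s) (τ - s) x - oseenDuhamel 1 s v v τ x :=
    fun τ hτ => Eventually.of_forall fun x => hmild s τ hτ.1 (hτ.2.trans hT₂0) x
  have hv₂ : ∀ τ ∈ Ioo s T₂, (fun τ y => v τ (y + a)) τ =ᵐ[volume] fun x =>
      UnboundedOperators.heatExtension (v s) (τ - s) x -
        oseenDuhamel 1 s (fun τ y => v τ (y + a)) (fun τ y => v τ (y + a)) τ x := by
    intro τ hτ
    refine Eventually.of_forall fun x => ?_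
    have hm := hmild s τ hτ.1 (hτ.2.trans hT₂0) (x + a)
    have hheat : UnboundedOperators.heatExtension (v s) (τ - s) (x + a) =
        UnboundedOperators.heatExtension (v s) (τ - s) x := by
      rw [← heatExtension_comp_add_right (v s) a (τ - s) x]
      congr 1
      funext z
      rw [ha]
      exact h z l
    show v τ (x + a) = UnboundedOperators.heatExtension (v s) (τ - s) x -
      oseenDuhamel 1 s (fun τ y => v τ (y + a)) (fun τ y => v τ (y + a)) τ x
    rw [oseenDuhamel_comp_add_right 1 s v v a τ x, ← hheat]
    exact hm
  have hae := oseenMild_bounded_unique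
    (U := fun τ x => UnboundedOperators.heatExtension (v s) (τ - s) x)
    one_pos (le_max_right B 0) hum hvm hB' hvM hu hv₂
  have ht : t ∈ Ioo s T₂ := ⟨hst', htT₂⟩
  have hg : Continuous fun y => v t (y + a) :=
    (continuous_slice hcont ht0).comp (continuous_id.add continuous_const)
  have heq : v t = fun y => v t (y + a) :=
    ((continuous_slice hcont ht0).ae_eq_iff_eq volume hg).1 (hae t ht)
  have hy := congrFun heq y
  rw [ha] at hy
  exact hy.symm

/-- **(T) translation invariance propagates BACKWARD** — time analyticity (`analyticOnNhd_uncurry`) and the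
identity theorem on the connected interval `(−∞,0)` (Masuda 1967's move replacing backward uniqueness): if
every slice `v(t)`, `s ≤ t < 0`, is invariant under translations along `e`, then so is every slice `v(t)`,
`t < 0`. -/
theorem translate_eq_backward (hcont : ContinuousOn (uncurry v) (Iio (0 : ℝ) ×ˢ univ))
    (hbdd : ∀ δ : ℝ, 0 < δ → ∃ B : ℝ, ∀ t < -δ, ∀ y : (EuclideanSpace ℝ (Fin 3)), ‖v t y‖ ≤ B)
    (hmild : ∀ s t : ℝ, s < t → t < 0 → ∀ y : (EuclideanSpace ℝ (Fin 3)),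
      v t y = UnboundedOperators.heatExtension (v s) (t - s) y - oseenDuhamel 1 s v v t y)
    {s : ℝ} (hs : s < 0) {e : (EuclideanSpace ℝ (Fin 3))}
    (h : ∀ t, s ≤ t → t < 0 → ∀ (y : (EuclideanSpace ℝ (Fin 3))) (l : ℝ), v t (y + l • e) = v t y) :
    ∀ t < 0, ∀ (y : (EuclideanSpace ℝ (Fin 3))) (l : ℝ), v t (y + l • e) = v t y := by
  intro t ht y l
  have hg : AnalyticOnNhd ℝ (fun τ => v τ (y + l • e) - v τ y) (Iio 0) := by
    intro τ hτ
    have h1 : AnalyticAt ℝ (uncurry v) (τ, y + l • e) :=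
      analyticOnNhd_uncurry hcont hbdd hmild _ (mem_prod.2 ⟨hτ, mem_univ _⟩)
    have h2 : AnalyticAt ℝ (uncurry v) (τ, y) :=
      analyticOnNhd_uncurry hcont hbdd hmild _ (mem_prod.2 ⟨hτ, mem_univ _⟩)
    have hι₁ : AnalyticAt ℝ (fun σ : ℝ => (σ, y + l • e)) τ := analyticAt_id.prod analyticAt_const
    have hι₂ : AnalyticAt ℝ (fun σ : ℝ => (σ, y)) τ := analyticAt_id.prod analyticAt_const
    have h1' : AnalyticAt ℝ (fun σ => v σ (y + l • e)) τ := h1.comp_of_eq hι₁ rfl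
    have h2' : AnalyticAt ℝ (fun σ => v σ y) τ := h2.comp_of_eq hι₂ rfl
    exact h1'.sub h2'
  have hs2 : s / 2 ∈ Iio (0 : ℝ) := by
    simp only [mem_Iio]
    linarith
  have hev : (fun τ => v τ (y + l • e) - v τ y) =ᶠ[𝓝 (s / 2)] 0 := by
    filter_upwards [isOpen_Ioo.mem_nhds (show s / 2 ∈ Ioo s 0 from ⟨by linarith, by linarith⟩)]
      with τ hτ
    simp only [Pi.zero_apply, sub_eq_zero]
    exact h τ hτ.1.le hτ.2 y l
  have := hg.eqOn_zero_of_preconnected_of_eventuallyEq_zero isPreconnected_Iio hs2 hev ht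
  simpa [sub_eq_zero] using this

/-- **(D) slice gradient bound** (KNSS 2009 Prop. 4.1 = tree THEOREM `knss2009_smoothing_holds` with `k = 1`,
`l = 0`): every slice `v(s)`, `s < 0`, of an Oseen-ancient field has bounded gradient.  Restart the Oseen
integral equation from the bounded continuous slice `v(2s)` on the window `(2s, s/2)`; the class identity
`hmild` is POINTWISE, so the smooth canonical representative of KNSS Prop. 4.1 coincides with `v s` itself. -/
theorem exists_fderiv_slice_bound (hcont : ContinuousOn (uncurry v) (Iio (0 : ℝ) ×ˢ univ))
    (hbdd : ∀ δ : ℝ, 0 < δ → ∃ B : ℝ, ∀ t < -δ, ∀ y : (EuclideanSpace ℝ (Fin 3)), ‖v t y‖ ≤ B)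
    (hmild : ∀ s t : ℝ, s < t → t < 0 → ∀ y : (EuclideanSpace ℝ (Fin 3)),
      v t y = UnboundedOperators.heatExtension (v s) (t - s) y - oseenDuhamel 1 s v v t y)
    {s : ℝ} (hs : s < 0) : ∃ M' : ℝ, ∀ y, ‖fderiv ℝ (v s) y‖ ≤ M' := by
  have hT : 2 * s < s / 2 := by linarith
  have h2s0 : 2 * s < 0 := by linarith
  obtain ⟨B, hB⟩ := hbdd (-s / 2) (by linarith)
  set M : ℝ := max B 0 with hM
  have hM0 : 0 ≤ M := le_max_right _ _
  have hbound : ∀ t < s / 2, ∀ y, ‖v t y‖ ≤ M := fun t ht y =>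
    (hB t (by linarith) y).trans (le_max_left _ _)
  -- hypotheses of KNSS Prop. 4.1 on the window `(2s, s/2)` with datum `v (2s)`
  have ha : AEStronglyMeasurable (v (2 * s)) volume :=
    (continuous_slice hcont h2s0).aestronglyMeasurable
  have haM : eLpNorm (v (2 * s)) ∞ volume ≤ ENNReal.ofReal M := by
    rw [eLpNorm_exponent_top]
    exact eLpNormEssSup_le_of_ae_bound (Eventually.of_forall fun y => hbound _ (by linarith) y)
  have hsub : Ioo (2 * s) (s / 2) ×ˢ (univ : Set (EuclideanSpace ℝ (Fin 3))) ⊆ Iio 0 ×ˢ univ :=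
    prod_mono (fun t ht => lt_trans ht.2 (by linarith)) subset_rfl
  have hu : AEStronglyMeasurable (uncurry v) (volume.restrict (Ioo (2 * s) (s / 2) ×ˢ univ)) :=
    (hcont.mono hsub).aestronglyMeasurable (measurableSet_Ioo.prod MeasurableSet.univ)
  have hub : ∀ t ∈ Ioo (2 * s) (s / 2), eLpNorm (v t) ∞ volume ≤ ENNReal.ofReal M := by
    intro t ht
    rw [eLpNorm_exponent_top]
    exact eLpNormEssSup_le_of_ae_bound (Eventually.of_forall fun y => hbound t ht.2 y)
  have hmild' : ∀ t ∈ Ioo (2 * s) (s / 2), v t =ᵐ[volume] fun x =>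
      UnboundedOperators.heatExtension (v (2 * s)) (1 * (t - 2 * s)) x
        - oseenDuhamel 1 (2 * s) v v t x := fun t ht =>
    Eventually.of_forall fun x => by
      rw [one_mul]; exact hmild (2 * s) t ht.1 (by linarith [ht.2]) x
  obtain ⟨-, -, hk⟩ := knss2009_smoothing_holds (EuclideanSpace ℝ (Fin 3)) one_pos hT hM0 ha haM hu hub hmild'
  obtain ⟨C, hC⟩ := hk 1 0
  have hsmem : s ∈ Ioo (2 * s) (s / 2) := ⟨by linarith, by linarith⟩
  -- the canonical representative IS `v s` (pointwise identity of the class)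
  have hrep : (fun y => iteratedDeriv 0 (fun τ =>
      UnboundedOperators.heatExtension (v (2 * s)) (1 * (τ - 2 * s)) y
        - oseenDuhamel 1 (2 * s) v v τ y) s) = v s := by
    funext y
    rw [iteratedDeriv_zero, one_mul]
    exact (hmild (2 * s) s (by linarith) hs y).symm
  have hpos : 0 < (s - 2 * s) ^ (((1 : ℕ) : ℝ) / 2 + ((0 : ℕ) : ℝ)) := by
    apply Real.rpow_pos_of_pos; linarith
  refine ⟨C / (s - 2 * s) ^ (((1 : ℕ) : ℝ) / 2 + ((0 : ℕ) : ℝ)), fun y => ?_⟩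
  have h := hC s hsmem y
  rw [hrep, norm_iteratedFDeriv_one] at h
  rw [le_div_iff₀ hpos, mul_comm]
  exact h

end Summit.NavierStokesRegularity.NavierStokesRegularity.Theorems.LocalSineTubeDoorProfileAlignedWindowRigidityAncient

end
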